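import Summits.ResolutionOfSingularities.ResolutionOfSingularities.Theorems.FrobeniusLadderFInjectiveMacaulayficationPointFixableCentre
import Summits.ResolutionOfSingularities.ResolutionOfSingularities.Theorems.FrobeniusLadderFInjectiveMacaulayficationClauseLocalizesScheme
import Mathlib.AlgebraicGeometry.Morphisms.FiniteType
import Mathlib.Topology.JacobsonSpace
import HarnessLib

/-!
# CurveStageSig §C4: FULL at the non-closed points over `Z` from a FINITE bad set over `Z` (Jacobson argument)
# (crux `FInjectiveMacaulayfication` stmt-ResolutionOfSingularities-15315, chain w45a; hole-#3β local-currency Sig of record, R12.38)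

[OURS · L1 W4.5a · res-L1-w45a-lead-1 gen 4] Support file (`--supports stmt-ResolutionOfSingularities-15315 --as helper`) for the
crux `FrobeniusLadder.FInjectiveMacaulayfication`; NOT a statement of any manuscript; AI-written, weaker than expert review.
Statement = §C4 `stub_fcNonclosed_of_finite` of res-L1-w45a-strat-1's `L/res-L1-w45a-strat-1/CurveStageSig.lean` VERBATIM (prefix dropped).

THE LEMMA (`fcNonclosed_of_finite`). `X₂` locally of finite type over a field `k`, `π : X₂ ⟶ X₁`, `Z ⊆ X₁` closed. If the FULL
clause (domain ∧ Cohen–Macaulay ∧ Frobenius-closed parameter ideals) GENERIZES on `X₂` (hypothesis `hgen`) and the points of `X₂` over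
`Z` failing it form a FINITE set, then the FULL clause holds at EVERY NON-CLOSED point of `X₂` over `Z`. So the input «FULL at the
non-closed points over the centre» of §C0/§C3 (`CurveStageGlue`, `CurveStageProducer`) and of #3β is what census and engines deliver:
finitely many bad points. PROOF: `X₂` is a Jacobson space (Mathlib `LocallyOfFiniteType.jacobsonSpace`); for a non-closed `x` over `Z`
the closed points of `closure {x}` are dense in it (`closure_inter_closedPoints`), so they are not all in the finite bad set (else they
form a finite, hence closed, hence already-closed dense subset, forcing `x` closed); a good closed `y ∈ closure {x}` lies over `Z`
(`Z` closed) and `hgen x y (x ⤳ y)` transfers the clause. No named facts. [folklore]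

ALSO (same argument, the forms the producers consume):
* `full_nonclosed_of_gen_of_finite_closedBad` — it suffices that the CLOSED bad points over `Z` are finite (the proof only ever
  tests closed points), `hgen` kept as a binder;
* `full_nonclosed_of_finite_closedBad` — the same with `hgen` DISCHARGED in characteristic `p` (`p` prime, `CharP k p`): the FULL
  clause generizes on a scheme locally of finite type over `k` by the tree's `ClauseLocalizes.fiClause_of_specializes`
  (`…ClauseLocalizesScheme`, E5: the clause localizes + `𝒪_x ≅ (𝒪_y)_P`, Stacks 01J7) — so strat-1's caveat «the F-part of `hgen` is
  named-fact-sized» does not arise for THIS clause (Frobenius-closedness of parameter ideals localizes elementarily; no Datta–Murayama);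
* `full_over_of_finite_closedBad` — hence FULL at EVERY point over `Z` outside the finite closed bad set.
So a census / engine that certifies the clause at all but finitely many CLOSED points over the centre delivers the «FULL at the
non-closed points over the centre» input of §C0/§C3 and of the 3-datum door (`DoorOfBlowupData`) for free.
-/

-- single-problem summit: the doubled namespace component is forced
set_option linter.dupNamespace false

noncomputable section

open AlgebraicGeometry CategoryTheory Literature.AlgebraicGeometry.Resolution TopologicalSpace IsLocalRing

namespace Summit.ResolutionOfSingularities.ResolutionOfSingularities.Theorems.FInjectiveMacaulayfication.CurveStageFcOfFinite

open Summit.ResolutionOfSingularities.ResolutionOfSingularities.Theorems.FInjectiveMacaulayfication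

/-- **Core form — FULL at non-closed points over `Z` from finitely many CLOSED bad points over `Z`, the clause generizing**
(`hgen` a binder). Jacobson argument of the module docstring; only closed points are ever tested against the bad set. [folklore] -/
theorem full_nonclosed_of_gen_of_finite_closedBad : ∀ (p : ℕ) (k : Type) [Field k] (X₁ X₂ : Scheme.{0})
    (f₂ : X₂ ⟶ Spec (.of k)) (π : X₂ ⟶ X₁), LocallyOfFiniteType f₂ → ∀ (Z : Set X₁), IsClosed Z →
    -- hgen: the FULL clause generizes on X₂
    (∀ x y : X₂, x ⤳ y → (IsDomain (X₂.presheaf.stalk y) ∧ ∀ d : ℕ, ringKrullDim (X₂.presheaf.stalk y) = d →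
      ∀ s : Fin d → X₂.presheaf.stalk y, (Ideal.span (Set.range s)).radical.IsMaximal →
        RingTheory.Sequence.IsWeaklyRegular (X₂.presheaf.stalk y) (List.ofFn s) ∧
        ∀ t : X₂.presheaf.stalk y, (∃ e : ℕ, t ^ p ^ e ∈ Ideal.span ((fun z : X₂.presheaf.stalk y => z ^ p ^ e) ''
          (Ideal.span (Set.range s) : Set (X₂.presheaf.stalk y)))) → t ∈ Ideal.span (Set.range s)) → (IsDomain (X₂.presheaf.stalk x) ∧ ∀ d : ℕ, ringKrullDim (X₂.presheaf.stalk x) = d →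
      ∀ s : Fin d → X₂.presheaf.stalk x, (Ideal.span (Set.range s)).radical.IsMaximal →
        RingTheory.Sequence.IsWeaklyRegular (X₂.presheaf.stalk x) (List.ofFn s) ∧
        ∀ t : X₂.presheaf.stalk x, (∃ e : ℕ, t ^ p ^ e ∈ Ideal.span ((fun z : X₂.presheaf.stalk x => z ^ p ^ e) ''
          (Ideal.span (Set.range s) : Set (X₂.presheaf.stalk x)))) → t ∈ Ideal.span (Set.range s))) →
    Set.Finite {x : X₂ | IsClosed ({x} : Set X₂) ∧ π.base x ∈ Z ∧ ¬ (IsDomain (X₂.presheaf.stalk x) ∧ ∀ d : ℕ, ringKrullDim (X₂.presheaf.stalk x) = d →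
      ∀ s : Fin d → X₂.presheaf.stalk x, (Ideal.span (Set.range s)).radical.IsMaximal →
        RingTheory.Sequence.IsWeaklyRegular (X₂.presheaf.stalk x) (List.ofFn s) ∧
        ∀ t : X₂.presheaf.stalk x, (∃ e : ℕ, t ^ p ^ e ∈ Ideal.span ((fun z : X₂.presheaf.stalk x => z ^ p ^ e) ''
          (Ideal.span (Set.range s) : Set (X₂.presheaf.stalk x)))) → t ∈ Ideal.span (Set.range s))} →
    ∀ x : X₂, π.base x ∈ Z → ¬ IsClosed ({x} : Set X₂) → (IsDomain (X₂.presheaf.stalk x) ∧ ∀ d : ℕ, ringKrullDim (X₂.presheaf.stalk x) = d →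
      ∀ s : Fin d → X₂.presheaf.stalk x, (Ideal.span (Set.range s)).radical.IsMaximal →
        RingTheory.Sequence.IsWeaklyRegular (X₂.presheaf.stalk x) (List.ofFn s) ∧
        ∀ t : X₂.presheaf.stalk x, (∃ e : ℕ, t ^ p ^ e ∈ Ideal.span ((fun z : X₂.presheaf.stalk x => z ^ p ^ e) ''
          (Ideal.span (Set.range s) : Set (X₂.presheaf.stalk x)))) → t ∈ Ideal.span (Set.range s)) := by
  intro p k _ X₁ X₂ f₂ π hft Z hZ hgen hfin x hxZ hxcl
  classical
  haveI := hft
  haveI : JacobsonSpace X₂ := LocallyOfFiniteType.jacobsonSpace f₂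
  -- the closed points of `closure {x}` are dense in it, hence not all bad
  set C : Set X₂ := closure ({x} : Set X₂) ∩ closedPoints X₂ with hC
  have hCcl : closure C = closure ({x} : Set X₂) := by
    rw [hC, closure_inter_closedPoints isClosed_closure]
  -- every point of `C` lies over `Z`
  have hCZ : ∀ y ∈ C, π.base y ∈ Z := fun y hyC => by
    have h1 : π.base y ∈ closure (π.base '' ({x} : Set X₂)) :=
      image_closure_subset_closure_image π.base.hom.continuous ⟨y, hyC.1, rfl⟩
    rw [Set.image_singleton] at h1
    exact hZ.closure_subset_iff.mpr (Set.singleton_subset_iff.mpr hxZ) h1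
  have key : ∃ y ∈ C, (IsDomain (X₂.presheaf.stalk y) ∧ ∀ d : ℕ, ringKrullDim (X₂.presheaf.stalk y) = d →
      ∀ s : Fin d → X₂.presheaf.stalk y, (Ideal.span (Set.range s)).radical.IsMaximal →
        RingTheory.Sequence.IsWeaklyRegular (X₂.presheaf.stalk y) (List.ofFn s) ∧
        ∀ t : X₂.presheaf.stalk y, (∃ e : ℕ, t ^ p ^ e ∈ Ideal.span ((fun z : X₂.presheaf.stalk y => z ^ p ^ e) ''
          (Ideal.span (Set.range s) : Set (X₂.presheaf.stalk y)))) → t ∈ Ideal.span (Set.range s)) := by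
    by_contra hcon
    -- then `C` is inside the finite closed bad set, hence finite, hence closed, hence `= closure {x}`: `x` would be closed
    have hCfin : C.Finite := hfin.subset fun y hy => by
      refine ⟨?_, hCZ y hy, fun hgood => hcon ⟨y, hy, hgood⟩⟩
      exact hy.2
    have hCclosed : IsClosed C := by
      have : C = ⋃ y ∈ C, {y} := (Set.biUnion_of_singleton C).symm
      rw [this]
      exact hCfin.isClosed_biUnion fun y hy => hy.2
    have hCeq : C = closure ({x} : Set X₂) := by rw [← hCcl, hCclosed.closure_eq]
    have hxC : x ∈ C := by rw [hCeq]; exact subset_closure (Set.mem_singleton x)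
    exact hxcl hxC.2
  obtain ⟨y, hyC, hfull⟩ := key
  -- `x ⤳ y`, and the clause generizes
  exact hgen x y (specializes_iff_mem_closure.mpr hyC.1) hfull

/-- **§C4 — FULL at non-closed points over `Z` from finitely many bad points over `Z`** (CurveStageSig VERBATIM; Jacobson argument, see
the module docstring). [folklore] -/
theorem fcNonclosed_of_finite : ∀ (p : ℕ) (k : Type) [Field k] (X₁ X₂ : Scheme.{0}) (f₂ : X₂ ⟶ Spec (.of k)) (π : X₂ ⟶ X₁),
    LocallyOfFiniteType f₂ → QuasiCompact f₂ → ∀ (Z : Set X₁), IsClosed Z →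
    -- hgen: the FULL clause generizes on X₂
    (∀ x y : X₂, x ⤳ y →
      (IsDomain (X₂.presheaf.stalk y) ∧ ∀ d : ℕ, ringKrullDim (X₂.presheaf.stalk y) = d → ∀ s : Fin d → X₂.presheaf.stalk y,
        (Ideal.span (Set.range s)).radical.IsMaximal → RingTheory.Sequence.IsWeaklyRegular (X₂.presheaf.stalk y) (List.ofFn s) ∧
        ∀ t : X₂.presheaf.stalk y, (∃ e : ℕ, t ^ p ^ e ∈ Ideal.span ((fun z : X₂.presheaf.stalk y => z ^ p ^ e) ''
          (Ideal.span (Set.range s) : Set (X₂.presheaf.stalk y)))) → t ∈ Ideal.span (Set.range s)) →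
      (IsDomain (X₂.presheaf.stalk x) ∧ ∀ d : ℕ, ringKrullDim (X₂.presheaf.stalk x) = d → ∀ s : Fin d → X₂.presheaf.stalk x,
        (Ideal.span (Set.range s)).radical.IsMaximal → RingTheory.Sequence.IsWeaklyRegular (X₂.presheaf.stalk x) (List.ofFn s) ∧
        ∀ t : X₂.presheaf.stalk x, (∃ e : ℕ, t ^ p ^ e ∈ Ideal.span ((fun z : X₂.presheaf.stalk x => z ^ p ^ e) ''
          (Ideal.span (Set.range s) : Set (X₂.presheaf.stalk x)))) → t ∈ Ideal.span (Set.range s))) →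
    -- finitely many non-good points over Z
    Set.Finite {x : X₂ | π.base x ∈ Z ∧ ¬ (IsDomain (X₂.presheaf.stalk x) ∧ ∀ d : ℕ, ringKrullDim (X₂.presheaf.stalk x) = d →
      ∀ s : Fin d → X₂.presheaf.stalk x, (Ideal.span (Set.range s)).radical.IsMaximal →
        RingTheory.Sequence.IsWeaklyRegular (X₂.presheaf.stalk x) (List.ofFn s) ∧
        ∀ t : X₂.presheaf.stalk x, (∃ e : ℕ, t ^ p ^ e ∈ Ideal.span ((fun z : X₂.presheaf.stalk x => z ^ p ^ e) ''
          (Ideal.span (Set.range s) : Set (X₂.presheaf.stalk x)))) → t ∈ Ideal.span (Set.range s))} →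
    ∀ x : X₂, π.base x ∈ Z → ¬ IsClosed ({x} : Set X₂) →
      IsDomain (X₂.presheaf.stalk x) ∧ ∀ d : ℕ, ringKrullDim (X₂.presheaf.stalk x) = d → ∀ s : Fin d → X₂.presheaf.stalk x,
        (Ideal.span (Set.range s)).radical.IsMaximal → RingTheory.Sequence.IsWeaklyRegular (X₂.presheaf.stalk x) (List.ofFn s) ∧
        ∀ t : X₂.presheaf.stalk x, (∃ e : ℕ, t ^ p ^ e ∈ Ideal.span ((fun z : X₂.presheaf.stalk x => z ^ p ^ e) ''
          (Ideal.span (Set.range s) : Set (X₂.presheaf.stalk x)))) → t ∈ Ideal.span (Set.range s) := by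
  intro p k _ X₁ X₂ f₂ π hft _ Z hZ hgen hfin x hxZ hxcl
  exact full_nonclosed_of_gen_of_finite_closedBad p k X₁ X₂ f₂ π hft Z hZ hgen
    (hfin.subset fun y hy => ⟨hy.2.1, hy.2.2⟩) x hxZ hxcl

/-- **FULL at non-closed points over `Z` from finitely many CLOSED bad points over `Z` — `hgen` discharged** (characteristic `p`):
on a scheme locally of finite type over a field of characteristic `p` the FULL clause generizes
(`ClauseLocalizes.fiClause_of_specializes`: the clause localizes, E5, + `𝒪_x ≅ (𝒪_y)_P`, Stacks 01J7), so the core form applies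
with no generization binder. [folklore] -/
theorem full_nonclosed_of_finite_closedBad : ∀ (p : ℕ), p.Prime → ∀ (k : Type) [Field k] [CharP k p] (X₁ X₂ : Scheme.{0})
    (f₂ : X₂ ⟶ Spec (.of k)) (π : X₂ ⟶ X₁), LocallyOfFiniteType f₂ → ∀ (Z : Set X₁), IsClosed Z →
    Set.Finite {x : X₂ | IsClosed ({x} : Set X₂) ∧ π.base x ∈ Z ∧ ¬ (IsDomain (X₂.presheaf.stalk x) ∧ ∀ d : ℕ, ringKrullDim (X₂.presheaf.stalk x) = d →
      ∀ s : Fin d → X₂.presheaf.stalk x, (Ideal.span (Set.range s)).radical.IsMaximal →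
        RingTheory.Sequence.IsWeaklyRegular (X₂.presheaf.stalk x) (List.ofFn s) ∧
        ∀ t : X₂.presheaf.stalk x, (∃ e : ℕ, t ^ p ^ e ∈ Ideal.span ((fun z : X₂.presheaf.stalk x => z ^ p ^ e) ''
          (Ideal.span (Set.range s) : Set (X₂.presheaf.stalk x)))) → t ∈ Ideal.span (Set.range s))} →
    ∀ x : X₂, π.base x ∈ Z → ¬ IsClosed ({x} : Set X₂) → (IsDomain (X₂.presheaf.stalk x) ∧ ∀ d : ℕ, ringKrullDim (X₂.presheaf.stalk x) = d →
      ∀ s : Fin d → X₂.presheaf.stalk x, (Ideal.span (Set.range s)).radical.IsMaximal →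
        RingTheory.Sequence.IsWeaklyRegular (X₂.presheaf.stalk x) (List.ofFn s) ∧
        ∀ t : X₂.presheaf.stalk x, (∃ e : ℕ, t ^ p ^ e ∈ Ideal.span ((fun z : X₂.presheaf.stalk x => z ^ p ^ e) ''
          (Ideal.span (Set.range s) : Set (X₂.presheaf.stalk x)))) → t ∈ Ideal.span (Set.range s)) := by
  intro p hp k _ _ X₁ X₂ f₂ π hft Z hZ hfin x hxZ hxcl
  haveI := hft
  haveI : Fact p.Prime := ⟨hp⟩
  haveI : IsLocallyNoetherian X₂ := LocallyOfFiniteType.isLocallyNoetherian f₂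
  refine full_nonclosed_of_gen_of_finite_closedBad p k X₁ X₂ f₂ π hft Z hZ (fun x' y hxy hy => ?_) hfin x hxZ hxcl
  haveI : CharP (X₂.presheaf.stalk y) p := Negative.charP_stalk hp.ne_zero f₂ y
  exact ClauseLocalizes.fiClause_of_specializes p hxy hy

/-- **FULL at EVERY point over `Z` outside a finite set of closed bad points** (characteristic `p`): closed points outside the
set by definition, non-closed points by `full_nonclosed_of_finite_closedBad`. This is the form a census delivers: certify the
clause at all but finitely many closed points over the centre, and the «FULL at the non-closed points over the centre» inputs of
§C0/§C3 (`CurveStageGlue`, `CurveStageProducer`) and of `DoorOfBlowupData` follow. [folklore] -/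
theorem full_over_of_finite_closedBad : ∀ (p : ℕ), p.Prime → ∀ (k : Type) [Field k] [CharP k p] (X₁ X₂ : Scheme.{0})
    (f₂ : X₂ ⟶ Spec (.of k)) (π : X₂ ⟶ X₁), LocallyOfFiniteType f₂ → ∀ (Z : Set X₁), IsClosed Z →
    ∀ (B : Set X₂), B.Finite → (∀ x : X₂, IsClosed ({x} : Set X₂) → π.base x ∈ Z → x ∉ B → (IsDomain (X₂.presheaf.stalk x) ∧ ∀ d : ℕ, ringKrullDim (X₂.presheaf.stalk x) = d →
      ∀ s : Fin d → X₂.presheaf.stalk x, (Ideal.span (Set.range s)).radical.IsMaximal →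
        RingTheory.Sequence.IsWeaklyRegular (X₂.presheaf.stalk x) (List.ofFn s) ∧
        ∀ t : X₂.presheaf.stalk x, (∃ e : ℕ, t ^ p ^ e ∈ Ideal.span ((fun z : X₂.presheaf.stalk x => z ^ p ^ e) ''
          (Ideal.span (Set.range s) : Set (X₂.presheaf.stalk x)))) → t ∈ Ideal.span (Set.range s))) →
    ∀ x : X₂, π.base x ∈ Z → x ∉ B → (IsDomain (X₂.presheaf.stalk x) ∧ ∀ d : ℕ, ringKrullDim (X₂.presheaf.stalk x) = d →
      ∀ s : Fin d → X₂.presheaf.stalk x, (Ideal.span (Set.range s)).radical.IsMaximal →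
        RingTheory.Sequence.IsWeaklyRegular (X₂.presheaf.stalk x) (List.ofFn s) ∧
        ∀ t : X₂.presheaf.stalk x, (∃ e : ℕ, t ^ p ^ e ∈ Ideal.span ((fun z : X₂.presheaf.stalk x => z ^ p ^ e) ''
          (Ideal.span (Set.range s) : Set (X₂.presheaf.stalk x)))) → t ∈ Ideal.span (Set.range s)) := by
  intro p hp k _ _ X₁ X₂ f₂ π hft Z hZ B hB hgood x hxZ hxB
  by_cases hxcl : IsClosed ({x} : Set X₂)
  · exact hgood x hxcl hxZ hxB
  · refine full_nonclosed_of_finite_closedBad p hp k X₁ X₂ f₂ π hft Z hZ (hB.subset fun y hy => ?_) x hxZ hxcl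
    by_contra hyB
    exact hy.2.2 (hgood y hy.1 hy.2.1 hyB)

end Summit.ResolutionOfSingularities.ResolutionOfSingularities.Theorems.FInjectiveMacaulayfication.CurveStageFcOfFinite

end
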